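import Mathlib.Analysis.SpecialFunctions.Pow.Real
import HarnessLib

/-!
# Route `UnitScaleTilt`, crux K1 «MinimiserStabilityRegPr» (stmt-QuantumFields-19200), route-R E′ path (α′), (E1-b) covariant, row (hK₂-cov) — FILE F4b-cov (i) «SCALINGS»:
# the pure-real bookkeeping of the weighted row — every frame-junk coefficient of the framed pin row is `≲ (1+t)²∕√ℓ` once `τ₁ ≤ t∕ℓ`, `τ₂ ≤ t∕ℓ²`, `m ≍ ℓ∕2`

Cell `ym3-torus`, width seat `ym3-torus-px11` (gen 3), LEAD of the (hK₂-cov) chain (routeR-w3 g6 WORDS (8)–(10), THE CUT 22:51:18Z: F4b∕F4c = px11); LOCATE 19200 evidence #57.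
`--kind proof --supports stmt-QuantumFields-19200 --as helper`, count-neutral.  THEOREMS ONLY (0 `def`, 0 `sorry`).  YM₃ on T³ is a ladder rung (R3) — not d = 4, not infinite
volume, not a mass gap, not the Clay problem; nothing here claims the stub, the crux or the gap.

THE POINT.  The near row of the (hK₂-cov) transplant (✓ `Prop7CovInterpErrorPinRows.tdist_mul_norm_le_of_laplace_defect` + ✓ `Prop7CovPinJunkPhi.J1_le` + ✓ `Prop7CovPinJunkPhiSq.J2_le` +
✓ `Prop7CovPinCharge.norm_covLaplace_centre_le_of_cutoff`) comes with explicit coefficients in the frame rows `τ₁, τ₂`, the half-radius `m` and the scale `ℓ = L^k`; at the member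
`τ₁ = C′e^{C′∕ℓ}∕ℓ`, `τ₂ = τ₁∕ℓ` (✓ `Prop7MemberBallFrames.exists_ballFrame_of_regPr`).  This file is the scalar half of F4b-cov: with `t ≥ 0`, `τ₁ ≤ t∕ℓ`, `τ₂ ≤ t∕ℓ²`, `2m+1 ≤ ℓ ≤ 2m+2`,
`ℓ ≥ 1024`, every coefficient is bounded by an absolute multiple of `(1+t)²∕√ℓ` (times `√𝓜`), and `near_algebra` adds the four pieces of the pin row up.  No lattice object appears.

WHAT IS PROVED (ns `…Theorems.Prop7CovWeightedRowScalings`): `half_letters`, `quotient_letters` (ℕ); `sqrt_letters`, `cJ2_le` (`J₂`-coefficient `≤ 29088t²(1+t)²∕ℓ²`), `affine_row_le`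
(`aτ₁ + bτ₂ + cτ₁² ≤ (a+b+c)t(1+t)∕√ℓ`), `cJ1_le` (`J₁`-coefficient `≤ 1200t(1+t)∕√ℓ`), `first_term_le`, `potential_term_le`, `cutoff_const_le`, `far_const_le` (`16·8064³∕R³ ≤ 2⁷⁰∕ℓ³`),
`near_algebra` (ℝ).  HONEST SCOPE: elementary real inequalities; nothing of Bałaban's is asserted.

References: T. Bałaban, CMP 99 (1985) 389–434 [Balaban1985BackgroundPropagators] ((3.35) p.396); M. Giaquinta, Princeton UP 1983 [Giaquinta1984] (Ch. III §2).
-/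

set_option autoImplicit false

noncomputable section

namespace Summit.QuantumFields.YangMills.Theorems.Prop7CovWeightedRowScalings

/-! ## §1 Natural-number letters -/

/-- The half-scale letters: for `ℓ = L^k ≥ 1024` and `m := ⌊(ℓ−1)∕2⌋`, `3 ≤ m`, `2m+1 ≤ ℓ`, `ℓ ≤ 2m+2`, and `(s : ℝ) < ℓ∕2 ↔ s ≤ m`. [folklore] -/
theorem half_letters {ℓ : ℕ} (hℓ : 1024 ≤ ℓ) :
    3 ≤ (ℓ - 1) / 2 ∧ 2 * ((ℓ - 1) / 2) + 1 ≤ ℓ ∧ ℓ ≤ 2 * ((ℓ - 1) / 2) + 2 ∧ ∀ s : ℕ, ((s : ℝ) < (ℓ : ℝ) / 2 ↔ s ≤ (ℓ - 1) / 2) := by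
  refine ⟨by omega, by omega, by omega, fun s => ?_⟩
  constructor
  · intro h
    have h2 : (2 * s : ℝ) < ℓ := by linarith
    have h3 : 2 * s < ℓ := by exact_mod_cast h2
    omega
  · intro h
    have h3 : 2 * s + 1 ≤ ℓ := by omega
    have h4 : ((2 * s + 1 : ℕ) : ℝ) ≤ ℓ := by exact_mod_cast h3
    push_cast at h4
    linarith

/-- The quotient letters: `q = ⌊ℓ∕1024⌋ ≥ 1`, `1024q ≤ ℓ < 2048q`. [folklore] -/
theorem quotient_letters {ℓ : ℕ} (hℓ : 1024 ≤ ℓ) : 1 ≤ ℓ / 1024 ∧ 1024 * (ℓ / 1024) ≤ ℓ ∧ ℓ < 2048 * (ℓ / 1024) := by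
  have h1 : ℓ / 1024 * 1024 ≤ ℓ := Nat.div_mul_le_self ℓ 1024
  have h2 : ℓ < ℓ / 1024 * 1024 + 1024 := Nat.lt_div_mul_add (by norm_num)
  have h3 : 0 < ℓ / 1024 := Nat.div_pos hℓ (by norm_num)
  omega

/-! ## §2 Pure-real scalings (`τ₁ ≤ t∕ℓ`, `τ₂ ≤ t∕ℓ²`, `m ≤ ℓ∕2`, `ℓ ≥ 1024`) -/

/-- The `J₂` coefficient: `26496τ₁² + 162m²(2τ₂+8τ₁²)² ≤ 29088·t²(1+t)²∕ℓ²`. [folklore] -/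
theorem cJ2_le {t ℓ τ₁ τ₂ m : ℝ} (ht : 0 ≤ t) (hℓ : 1 ≤ ℓ) (h10 : 0 ≤ τ₁) (h20 : 0 ≤ τ₂) (h1 : τ₁ ≤ t / ℓ) (h2 : τ₂ ≤ t / ℓ ^ 2) (hm0 : 0 ≤ m) (hm : m ≤ ℓ / 2) :
    26496 * τ₁ ^ 2 + 162 * m ^ 2 * (2 * τ₂ + 8 * τ₁ ^ 2) ^ 2 ≤ 29088 * t ^ 2 * (1 + t) ^ 2 / ℓ ^ 2 := by
  have hℓ0 : 0 < ℓ := by linarith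
  have hτ₁sq : τ₁ ^ 2 ≤ t ^ 2 / ℓ ^ 2 := by
    rw [← div_pow]; exact pow_le_pow_left₀ h10 h1 2
  have hc : 2 * τ₂ + 8 * τ₁ ^ 2 ≤ (2 * t + 8 * t ^ 2) / ℓ ^ 2 := by
    have : (2 * t + 8 * t ^ 2) / ℓ ^ 2 = 2 * (t / ℓ ^ 2) + 8 * (t ^ 2 / ℓ ^ 2) := by ring
    rw [this]; linarith
  have hc0 : 0 ≤ 2 * τ₂ + 8 * τ₁ ^ 2 := by positivity
  have hcsq : (2 * τ₂ + 8 * τ₁ ^ 2) ^ 2 ≤ ((2 * t + 8 * t ^ 2) / ℓ ^ 2) ^ 2 := pow_le_pow_left₀ hc0 hc 2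
  have hpoly : (2 * t + 8 * t ^ 2) ^ 2 ≤ 64 * t ^ 2 * (1 + t) ^ 2 := by nlinarith [sq_nonneg t, mul_nonneg ht ht]
  have hm2 : m ^ 2 ≤ ℓ ^ 2 / 4 := by nlinarith
  have hA : 162 * m ^ 2 * (2 * τ₂ + 8 * τ₁ ^ 2) ^ 2 ≤ 162 * (ℓ ^ 2 / 4) * (((2 * t + 8 * t ^ 2) / ℓ ^ 2) ^ 2) := by gcongr
  have hB : 162 * (ℓ ^ 2 / 4) * (((2 * t + 8 * t ^ 2) / ℓ ^ 2) ^ 2) ≤ 2592 * t ^ 2 * (1 + t) ^ 2 / ℓ ^ 2 := by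
    rw [div_pow]
    have e : 162 * (ℓ ^ 2 / 4) * ((2 * t + 8 * t ^ 2) ^ 2 / (ℓ ^ 2) ^ 2) = (162 / 4) * (2 * t + 8 * t ^ 2) ^ 2 / ℓ ^ 2 := by
      field_simp
    rw [e, div_le_div_iff_of_pos_right (by positivity)]
    nlinarith
  have hC : 26496 * τ₁ ^ 2 ≤ 26496 * t ^ 2 * (1 + t) ^ 2 / ℓ ^ 2 := by
    have h1' : 26496 * τ₁ ^ 2 ≤ 26496 * (t ^ 2 / ℓ ^ 2) := by linarith
    refine h1'.trans ?_
    have e : 26496 * t ^ 2 * (1 + t) ^ 2 / ℓ ^ 2 = 26496 * (t ^ 2 * (1 + t) ^ 2 / ℓ ^ 2) := by ring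
    rw [e]
    refine mul_le_mul_of_nonneg_left ?_ (by norm_num)
    rw [div_le_div_iff_of_pos_right (by positivity)]
    nlinarith [sq_nonneg t, mul_nonneg ht ht, mul_nonneg (mul_nonneg ht ht) ht]
  have e : 29088 * t ^ 2 * (1 + t) ^ 2 / ℓ ^ 2 = 26496 * t ^ 2 * (1 + t) ^ 2 / ℓ ^ 2 + 2592 * t ^ 2 * (1 + t) ^ 2 / ℓ ^ 2 := by ring
  rw [e]; linarith

/-- Affine-quadratic frame rows scale to `t(1+t)∕√ℓ`: `aτ₁ + bτ₂ + cτ₁² ≤ (a+b+c)·t(1+t)∕√ℓ` (`a, b, c ≥ 0`). [folklore] -/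
theorem affine_row_le {t ℓ τ₁ τ₂ : ℝ} (ht : 0 ≤ t) (hℓ : 1 ≤ ℓ) (h10 : 0 ≤ τ₁) (h1 : τ₁ ≤ t / ℓ) (h2 : τ₂ ≤ t / ℓ ^ 2)
    {a b c : ℝ} (ha : 0 ≤ a) (hb : 0 ≤ b) (hc : 0 ≤ c) :
    a * τ₁ + b * τ₂ + c * τ₁ ^ 2 ≤ (a + b + c) * t * (1 + t) / Real.sqrt ℓ := by
  have hℓ0 : 0 < ℓ := by linarith
  have hr1 : 1 ≤ Real.sqrt ℓ := by rw [Real.le_sqrt (by norm_num) hℓ0.le]; linarith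
  have hr0 : 0 < Real.sqrt ℓ := by linarith
  have hrℓ : Real.sqrt ℓ ≤ ℓ := by
    have h := Real.sqrt_le_sqrt (show ℓ ≤ ℓ ^ 2 by nlinarith)
    rwa [Real.sqrt_sq hℓ0.le] at h
  have hℓ2 : Real.sqrt ℓ ≤ ℓ ^ 2 := hrℓ.trans (by nlinarith)
  -- the unit `u := t(1+t)∕√ℓ` dominates each row
  have hu : t / ℓ ≤ t * (1 + t) / Real.sqrt ℓ := by
    rw [div_le_div_iff₀ hℓ0 hr0]; nlinarith [mul_nonneg ht ht, mul_nonneg (mul_nonneg ht ht) hr0.le]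
  have hu2 : t / ℓ ^ 2 ≤ t * (1 + t) / Real.sqrt ℓ := by
    rw [div_le_div_iff₀ (by positivity) hr0]; nlinarith [mul_nonneg ht ht, mul_nonneg (mul_nonneg ht ht) hr0.le, mul_nonneg ht (sub_nonneg.2 hℓ2)]
  have hu3 : τ₁ ^ 2 ≤ t * (1 + t) / Real.sqrt ℓ := by
    have h3 : τ₁ ^ 2 ≤ (t / ℓ) ^ 2 := pow_le_pow_left₀ h10 h1 2
    refine h3.trans ?_
    rw [div_pow, div_le_div_iff₀ (by positivity) hr0]
    nlinarith [mul_nonneg ht ht, mul_nonneg (mul_nonneg ht ht) hr0.le, mul_nonneg (mul_nonneg ht ht) (sub_nonneg.2 hℓ2), mul_nonneg ht (sub_nonneg.2 hℓ2)]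
  have e : (a + b + c) * t * (1 + t) / Real.sqrt ℓ = a * (t * (1 + t) / Real.sqrt ℓ) + b * (t * (1 + t) / Real.sqrt ℓ) + c * (t * (1 + t) / Real.sqrt ℓ) := by ring
  rw [e]
  have ha' := mul_le_mul_of_nonneg_left (h1.trans hu) ha
  have hb' := mul_le_mul_of_nonneg_left (h2.trans hu2) hb
  have hc' := mul_le_mul_of_nonneg_left hu3 hc
  linarith

/-- `√ℓ` letters: `1 ≤ √ℓ ≤ ℓ`, `√ℓ·√ℓ = ℓ`, `√(ℓ³) = ℓ√ℓ`. [folklore] -/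
theorem sqrt_letters {ℓ : ℝ} (hℓ : 1 ≤ ℓ) :
    1 ≤ Real.sqrt ℓ ∧ Real.sqrt ℓ ≤ ℓ ∧ Real.sqrt ℓ * Real.sqrt ℓ = ℓ ∧ Real.sqrt (ℓ ^ 3) = ℓ * Real.sqrt ℓ := by
  have hℓ0 : 0 ≤ ℓ := by linarith
  have hr1 : 1 ≤ Real.sqrt ℓ := by rw [Real.le_sqrt (by norm_num) hℓ0]; linarith
  refine ⟨hr1, ?_, Real.mul_self_sqrt hℓ0, ?_⟩
  · have h := Real.sqrt_le_sqrt (show ℓ ≤ ℓ ^ 2 by nlinarith)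
    rwa [Real.sqrt_sq hℓ0] at h
  · rw [show ℓ ^ 3 = ℓ ^ 2 * ℓ by ring, Real.sqrt_mul (by positivity), Real.sqrt_sq hℓ0]

/-- The `J₁` coefficient: `4τ₁(√(576m₁)·√(108·𝓜)) + 12τ₁√𝓜 + (36τ₁²+6τ₂)(√((2(m₁+1))³)·√𝓜) ≤ 1200·t(1+t)·√𝓜∕√ℓ` for `m₁ + 1 ≤ ℓ`. [folklore] -/
theorem cJ1_le {t ℓ τ₁ τ₂ m₁ Mass : ℝ} (ht : 0 ≤ t) (hℓ : 1 ≤ ℓ) (h10 : 0 ≤ τ₁) (h20 : 0 ≤ τ₂) (h1 : τ₁ ≤ t / ℓ) (h2 : τ₂ ≤ t / ℓ ^ 2)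
    (hm0 : 0 ≤ m₁) (hm : m₁ + 1 ≤ ℓ) :
    4 * τ₁ * (Real.sqrt (576 * m₁) * Real.sqrt (108 * Mass)) + 12 * τ₁ * Real.sqrt Mass
        + (36 * τ₁ ^ 2 + 6 * τ₂) * (Real.sqrt ((2 * (m₁ + 1)) ^ 3) * Real.sqrt Mass)
      ≤ 1200 * t * (1 + t) * Real.sqrt Mass / Real.sqrt ℓ := by
  obtain ⟨hr1, hrℓ, hrr, hr3⟩ := sqrt_letters hℓ
  have hℓ0 : 0 < ℓ := by linarith
  have hr0 : 0 < Real.sqrt ℓ := by linarith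
  set r := Real.sqrt ℓ with hr
  set Q := Real.sqrt Mass with hQ
  have hQ0 : 0 ≤ Q := Real.sqrt_nonneg _
  -- `τ₁ ≤ t∕ℓ = t∕(r·r)`, `τ₂, τ₁² ≤ t(·)∕ℓ²`
  have hℓr : ℓ = r * r := hrr.symm
  -- term 1: `√(576 m₁) ≤ 24 r`, `√(108 Mass) ≤ 11 Q`
  have hA1 : Real.sqrt (576 * m₁) ≤ 24 * r := by
    rw [show (576 : ℝ) * m₁ = 24 ^ 2 * m₁ by norm_num, Real.sqrt_mul (by norm_num), Real.sqrt_sq (by norm_num)]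
    exact mul_le_mul_of_nonneg_left (Real.sqrt_le_sqrt (by linarith)) (by norm_num)
  have hA2 : Real.sqrt (108 * Mass) ≤ 11 * Q := by
    rw [Real.sqrt_mul (by norm_num)]
    refine mul_le_mul_of_nonneg_right ?_ hQ0
    rw [Real.sqrt_le_left (by norm_num)]; norm_num
  have hT1 : 4 * τ₁ * (Real.sqrt (576 * m₁) * Real.sqrt (108 * Mass)) ≤ 1056 * (t / ℓ) * r * Q := by
    have h := mul_le_mul hA1 hA2 (Real.sqrt_nonneg _) (by positivity)
    have h4 : 0 ≤ 4 * τ₁ := by positivity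
    calc 4 * τ₁ * (Real.sqrt (576 * m₁) * Real.sqrt (108 * Mass)) ≤ 4 * τ₁ * (24 * r * (11 * Q)) := mul_le_mul_of_nonneg_left h h4
      _ = 1056 * τ₁ * r * Q := by ring
      _ ≤ 1056 * (t / ℓ) * r * Q := by gcongr
  have hT1' : 1056 * (t / ℓ) * r * Q = 1056 * t * Q / r := by
    rw [hℓr]; field_simp
  -- term 2: `12τ₁Q ≤ 12 (t∕ℓ) Q ≤ 12 t Q ∕ r`
  have hT2 : 12 * τ₁ * Q ≤ 12 * t * Q / r := by
    have h := mul_le_mul_of_nonneg_right (mul_le_mul_of_nonneg_left h1 (by norm_num : (0:ℝ) ≤ 12)) hQ0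
    refine h.trans ?_
    rw [mul_div_assoc, mul_assoc, mul_assoc]
    refine mul_le_mul_of_nonneg_left ?_ (by norm_num)
    rw [← mul_div_assoc, div_mul_eq_mul_div, div_le_div_iff₀ hℓ0 hr0]
    nlinarith [mul_nonneg ht hQ0]
  -- term 3: `√((2(m₁+1))³) ≤ 3 ℓ r`, `36τ₁² + 6τ₂ ≤ (36t² + 6t)∕ℓ²`
  have hA3 : Real.sqrt ((2 * (m₁ + 1)) ^ 3) ≤ 3 * ℓ * r := by
    have hle : (2 * (m₁ + 1)) ^ 3 ≤ (3 * ℓ * r) ^ 2 := by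
      have e : (3 * ℓ * r) ^ 2 = 9 * ℓ ^ 2 * (r * r) := by ring
      rw [e, ← hℓr]
      nlinarith [pow_le_pow_left₀ (by positivity : (0:ℝ) ≤ 2 * (m₁ + 1)) (by linarith : 2 * (m₁ + 1) ≤ 2 * ℓ) 3, pow_pos hℓ0 3]
    have h := Real.sqrt_le_sqrt hle
    rwa [Real.sqrt_sq (by positivity)] at h
  have hc : 36 * τ₁ ^ 2 + 6 * τ₂ ≤ (36 * t ^ 2 + 6 * t) / ℓ ^ 2 := by
    have h3 : τ₁ ^ 2 ≤ t ^ 2 / ℓ ^ 2 := by rw [← div_pow]; exact pow_le_pow_left₀ h10 h1 2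
    have e : (36 * t ^ 2 + 6 * t) / ℓ ^ 2 = 36 * (t ^ 2 / ℓ ^ 2) + 6 * (t / ℓ ^ 2) := by ring
    rw [e]; linarith
  have hT3 : (36 * τ₁ ^ 2 + 6 * τ₂) * (Real.sqrt ((2 * (m₁ + 1)) ^ 3) * Q) ≤ (36 * t ^ 2 + 6 * t) / ℓ ^ 2 * (3 * ℓ * r * Q) := by
    have h0 : 0 ≤ 36 * τ₁ ^ 2 + 6 * τ₂ := by positivity
    exact mul_le_mul hc (mul_le_mul_of_nonneg_right hA3 hQ0) (by positivity) (by positivity)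
  have hT3' : (36 * t ^ 2 + 6 * t) / ℓ ^ 2 * (3 * ℓ * r * Q) = (108 * t ^ 2 + 18 * t) * Q / r := by
    rw [hℓr]; field_simp; ring
  -- sum
  have hsum : 1056 * t * Q / r + 12 * t * Q / r + (108 * t ^ 2 + 18 * t) * Q / r ≤ 1200 * t * (1 + t) * Q / r := by
    rw [← add_div, ← add_div, div_le_div_iff_of_pos_right hr0]
    nlinarith [mul_nonneg ht hQ0, mul_nonneg (mul_nonneg ht ht) hQ0]
  linarith [hT1, hT1', hT2, hT3, hT3']

/-- The first pin-row term: `√((2𝓜_B + 2A₁ℓ²J₂)∕ℓ) ≤ (2 + 242√A₁)(1+t)²·√𝓜∕√ℓ` once `𝓜_B ≤ 𝓜` and `J₂ ≤ 29088t²(1+t)²𝓜∕ℓ²`. [folklore] -/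
theorem first_term_le {t ℓ A₁ MB J₂ Mass : ℝ} (ht : 0 ≤ t) (hℓ : 1 ≤ ℓ) (hA₁ : 0 ≤ A₁) (hMB0 : 0 ≤ MB) (hMB : MB ≤ Mass)
    (hJ : J₂ ≤ 29088 * t ^ 2 * (1 + t) ^ 2 / ℓ ^ 2 * Mass) :
    Real.sqrt ((2 * MB + 2 * A₁ * ℓ ^ 2 * J₂) / ℓ) ≤ (2 + 242 * Real.sqrt A₁) * (1 + t) ^ 2 * Real.sqrt Mass / Real.sqrt ℓ := by
  have hℓ0 : 0 < ℓ := by linarith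
  have hMass : 0 ≤ Mass := hMB0.trans hMB
  have hsA : 0 ≤ Real.sqrt A₁ := Real.sqrt_nonneg _
  have hrhs0 : 0 ≤ (2 + 242 * Real.sqrt A₁) * (1 + t) ^ 2 * Real.sqrt Mass / Real.sqrt ℓ := by positivity
  rw [← Real.sqrt_sq hrhs0]
  refine Real.sqrt_le_sqrt ?_
  rw [div_pow, mul_pow, mul_pow, Real.sq_sqrt hMass, Real.sq_sqrt hℓ0.le, div_le_div_iff₀ hℓ0 hℓ0]
  have hJ' : 2 * A₁ * ℓ ^ 2 * J₂ ≤ 2 * A₁ * (29088 * t ^ 2 * (1 + t) ^ 2 * Mass) := by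
    have h := mul_le_mul_of_nonneg_left hJ (by positivity : (0:ℝ) ≤ 2 * A₁ * ℓ ^ 2)
    refine h.trans (le_of_eq ?_)
    field_simp
  have hsq : 4 + 58564 * A₁ ≤ (2 + 242 * Real.sqrt A₁) ^ 2 := by
    have e : Real.sqrt A₁ ^ 2 = A₁ := Real.sq_sqrt hA₁
    nlinarith
  set X : ℝ := (1 + t) ^ 2 with hX
  have h14 : 1 ≤ X := by rw [hX]; nlinarith
  have hX0 : 0 ≤ X := by positivity
  have hT : t ^ 2 * X ≤ X ^ 2 := by
    rw [hX]; nlinarith [sq_nonneg t, mul_nonneg ht (sq_nonneg (1 + t))]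
  have hXMℓ : 0 ≤ X ^ 2 * Mass * ℓ := by positivity
  have hL1 : 2 * MB * ℓ ≤ 2 * Mass * ℓ := by nlinarith
  have hL2 : 2 * A₁ * ℓ ^ 2 * J₂ * ℓ ≤ 58176 * A₁ * X ^ 2 * Mass * ℓ := by
    have h1 : 2 * A₁ * ℓ ^ 2 * J₂ * ℓ ≤ 2 * A₁ * (29088 * t ^ 2 * X * Mass) * ℓ := mul_le_mul_of_nonneg_right hJ' hℓ0.le
    have h2 : 2 * A₁ * (29088 * t ^ 2 * X * Mass) * ℓ = 58176 * A₁ * (t ^ 2 * X) * Mass * ℓ := by ring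
    have h3 : 58176 * A₁ * (t ^ 2 * X) * Mass * ℓ ≤ 58176 * A₁ * (X ^ 2) * Mass * ℓ := by
      have := mul_le_mul_of_nonneg_left hT (by positivity : (0:ℝ) ≤ 58176 * A₁)
      nlinarith [mul_nonneg (mul_nonneg (mul_nonneg (by norm_num : (0:ℝ) ≤ 58176) hA₁) (sub_nonneg.2 hT)) (mul_nonneg hMass hℓ0.le)]
    linarith
  have hR1 : (4 + 58564 * A₁) * (X ^ 2 * Mass * ℓ) ≤ (2 + 242 * Real.sqrt A₁) ^ 2 * (X ^ 2 * Mass * ℓ) := mul_le_mul_of_nonneg_right hsq hXMℓ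
  have hR2 : 2 * Mass * ℓ ≤ 4 * (X ^ 2 * Mass * ℓ) := by nlinarith [mul_nonneg (sub_nonneg.2 h14) (mul_nonneg hMass hℓ0.le), mul_nonneg hX0 (mul_nonneg (sub_nonneg.2 h14) (mul_nonneg hMass hℓ0.le))]
  have e1 : (2 * MB + 2 * A₁ * ℓ ^ 2 * J₂) * ℓ = 2 * MB * ℓ + 2 * A₁ * ℓ ^ 2 * J₂ * ℓ := by ring
  have e2 : (2 + 242 * Real.sqrt A₁) ^ 2 * X ^ 2 * Mass * ℓ = (2 + 242 * Real.sqrt A₁) ^ 2 * (X ^ 2 * Mass * ℓ) := by ring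
  rw [e1, e2]
  nlinarith [mul_nonneg hA₁ hXMℓ]

/-- The potential term: `½√(C_K·s)·√J₂ ≤ 86√C_K·(1+t)²·√𝓜∕√ℓ` once `s ≤ ℓ` and `J₂ ≤ 29088t²(1+t)²𝓜∕ℓ²`. [folklore] -/
theorem potential_term_le {t ℓ CK s J₂ Mass : ℝ} (ht : 0 ≤ t) (hℓ : 1 ≤ ℓ) (hCK : 0 ≤ CK) (hs0 : 0 ≤ s) (hs : s ≤ ℓ) (hJ0 : 0 ≤ J₂) (hMass : 0 ≤ Mass)
    (hJ : J₂ ≤ 29088 * t ^ 2 * (1 + t) ^ 2 / ℓ ^ 2 * Mass) :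
    2⁻¹ * Real.sqrt (CK * s) * Real.sqrt J₂ ≤ 86 * Real.sqrt CK * (1 + t) ^ 2 * Real.sqrt Mass / Real.sqrt ℓ := by
  have hℓ0 : 0 < ℓ := by linarith
  set W : ℝ := 86 * Real.sqrt CK * (1 + t) ^ 2 * Real.sqrt Mass / Real.sqrt ℓ with hW
  have hW0 : 0 ≤ 2 * W := by positivity
  have eW : (2 * W) ^ 2 = 29584 * CK * ((1 + t) ^ 2) ^ 2 * Mass / ℓ := by
    rw [hW]
    simp only [mul_pow, div_pow, Real.sq_sqrt hCK, Real.sq_sqrt hMass, Real.sq_sqrt hℓ0.le]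
    ring
  have hT : t ^ 2 * (1 + t) ^ 2 ≤ ((1 + t) ^ 2) ^ 2 := by nlinarith [sq_nonneg t, mul_nonneg ht (sq_nonneg (1 + t))]
  have hZ : CK * s * J₂ ≤ 29584 * CK * ((1 + t) ^ 2) ^ 2 * Mass / ℓ := by
    have h1 : CK * s * J₂ ≤ CK * ℓ * (29088 * t ^ 2 * (1 + t) ^ 2 / ℓ ^ 2 * Mass) :=
      mul_le_mul (mul_le_mul_of_nonneg_left hs hCK) hJ hJ0 (by positivity)
    have e : CK * ℓ * (29088 * t ^ 2 * (1 + t) ^ 2 / ℓ ^ 2 * Mass) = 29088 * CK * (t ^ 2 * (1 + t) ^ 2) * Mass / ℓ := by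
      field_simp
    rw [e] at h1
    refine h1.trans ?_
    rw [div_le_div_iff_of_pos_right hℓ0]
    nlinarith [mul_nonneg (mul_nonneg hCK (sub_nonneg.2 hT)) hMass, mul_nonneg (mul_nonneg hCK (sq_nonneg ((1 + t) ^ 2))) hMass]
  have hZ' : CK * s * J₂ ≤ (2 * W) ^ 2 := by rw [eW]; exact hZ
  calc 2⁻¹ * Real.sqrt (CK * s) * Real.sqrt J₂ = 2⁻¹ * Real.sqrt (CK * s * J₂) := by
        rw [mul_assoc, ← Real.sqrt_mul (by positivity : (0:ℝ) ≤ CK * s)]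
    _ ≤ 2⁻¹ * Real.sqrt ((2 * W) ^ 2) := by gcongr
    _ = W := by rw [Real.sqrt_sq hW0]; ring

/-- The cutoff constant: `(2700∕m²)·√#S ≤ 129600∕√ℓ` once `#S ≤ (2(m+1))³`, `ℓ ≤ 2m+2`, `2m+1 ≤ ℓ`, `ℓ ≥ 1024`. [folklore] -/
theorem cutoff_const_le {ℓ m cS : ℝ} (hℓ : 1024 ≤ ℓ) (hm1 : ℓ ≤ 2 * m + 2) (hm2 : 2 * m + 1 ≤ ℓ) (hcS0 : 0 ≤ cS) (hcS : cS ≤ (2 * (m + 1)) ^ 3) :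
    2700 / m ^ 2 * Real.sqrt cS ≤ 129600 / Real.sqrt ℓ := by
  have hℓ1 : 1 ≤ ℓ := by linarith
  obtain ⟨hr1, hrℓ, hrr, hr3⟩ := sqrt_letters hℓ1
  have hℓ0 : 0 < ℓ := by linarith
  have hm0 : 0 < m := by linarith
  have hr0 : 0 < Real.sqrt ℓ := by linarith
  -- `√cS ≤ 3 ℓ √ℓ` and `1∕m² ≤ 16∕ℓ²`
  have hS : Real.sqrt cS ≤ 3 * ℓ * Real.sqrt ℓ := by
    have hle : cS ≤ (3 * ℓ * Real.sqrt ℓ) ^ 2 := by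
      have e : (3 * ℓ * Real.sqrt ℓ) ^ 2 = 9 * ℓ ^ 2 * (Real.sqrt ℓ * Real.sqrt ℓ) := by ring
      rw [e, hrr]
      nlinarith [pow_le_pow_left₀ (by positivity : (0:ℝ) ≤ 2 * (m + 1)) (by linarith : 2 * (m + 1) ≤ 2 * ℓ) 3, pow_pos hℓ0 3]
    have h := Real.sqrt_le_sqrt hle
    rwa [Real.sqrt_sq (by positivity)] at h
  have hm4 : ℓ ≤ 4 * m := by linarith
  calc 2700 / m ^ 2 * Real.sqrt cS ≤ 2700 / m ^ 2 * (3 * ℓ * Real.sqrt ℓ) := by gcongr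
    _ ≤ 129600 / Real.sqrt ℓ := by
        rw [div_mul_eq_mul_div, div_le_div_iff₀ (by positivity) hr0]
        have e : 2700 * (3 * ℓ * Real.sqrt ℓ) * Real.sqrt ℓ = 8100 * ℓ * (Real.sqrt ℓ * Real.sqrt ℓ) := by ring
        rw [e, hrr]
        nlinarith [mul_pos hℓ0 hℓ0]

/-- The far constant: `16·(336·3·2³)³∕R³ ≤ 2⁷⁰∕ℓ³` once `ℓ ≤ 512·R`. [folklore] -/
theorem far_const_le {ℓ R : ℝ} (hℓ : 0 < ℓ) (hR : ℓ ≤ 512 * R) :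
    16 * (336 * (3 : ℝ) * (2 : ℝ) ^ 3) ^ 3 / R ^ 3 ≤ 2 ^ 70 / ℓ ^ 3 := by
  have hR0 : 0 < R := by linarith
  rw [div_le_div_iff₀ (by positivity) (by positivity)]
  have h3 : ℓ ^ 3 ≤ (512 * R) ^ 3 := pow_le_pow_left₀ hℓ.le hR 3
  nlinarith [pow_pos hR0 3]

/-- The near-row bookkeeping: the four scaled pieces of the framed pin row add up to `A·(1+2N²)²(1+t)²·Q∕r`, `A = C_p(132098 + 242√A₁) + 86√C_K + 1`. [folklore] -/
theorem near_algebra {t Q r Cp CK A₁ Nr s nv F C J1 Pot : ℝ} (ht : 0 ≤ t) (hQ : 0 ≤ Q) (hr : 0 < r) (hCp : 0 < Cp)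
    (hmain : s * nv ≤ 2 * Nr ^ 2 * Cp * (F + C + J1) + Pot)
    (hF : F ≤ (2 + 242 * Real.sqrt A₁) * (1 + t) ^ 2 * Q / r)
    (hC : C ≤ (2 * Nr ^ 2 * (129600 + 1200 * t * (1 + t)) + 96 * t * (1 + t)) * Q / r)
    (hJ1 : J1 ≤ 1200 * t * (1 + t) * Q / r)
    (hPot : Pot ≤ 86 * Real.sqrt CK * (1 + t) ^ 2 * Q / r) :
    s * nv ≤ (Cp * (132098 + 242 * Real.sqrt A₁) + 86 * Real.sqrt CK + 1) * (1 + 2 * Nr ^ 2) ^ 2 * (1 + t) ^ 2 * Q / r := by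
  set u : ℝ := Q / r with hu
  have hu0 : 0 ≤ u := by positivity
  set T : ℝ := (1 + t) ^ 2 with hT
  have hT1 : 1 ≤ T := by rw [hT]; nlinarith
  have htT : t * (1 + t) ≤ T := by rw [hT]; nlinarith
  set K : ℝ := 1 + 2 * Nr ^ 2 with hK
  have hN0 : 0 ≤ 2 * Nr ^ 2 := by positivity
  have hK1 : 1 ≤ K := by rw [hK]; linarith
  have hN2 : 2 * Nr ^ 2 ≤ K := by rw [hK]; linarith
  have hsA : 0 ≤ Real.sqrt A₁ := Real.sqrt_nonneg _
  have hsC : 0 ≤ Real.sqrt CK := Real.sqrt_nonneg _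
  have hTu : 0 ≤ T * u := by positivity
  -- pieces in the unit `T·u`
  have hF' : F ≤ (2 + 242 * Real.sqrt A₁) * (T * u) := by refine hF.trans (le_of_eq ?_); rw [hu, hT]; ring
  have hJ1' : J1 ≤ 1200 * (T * u) := by
    refine hJ1.trans ?_
    have e : 1200 * t * (1 + t) * Q / r = 1200 * ((t * (1 + t)) * u) := by rw [hu]; ring
    rw [e]
    exact mul_le_mul_of_nonneg_left (mul_le_mul_of_nonneg_right htT hu0) (by norm_num)
  have hC' : C ≤ (130800 * K + 96) * (T * u) := by
    refine hC.trans ?_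
    have e : (2 * Nr ^ 2 * (129600 + 1200 * t * (1 + t)) + 96 * t * (1 + t)) * Q / r
        = (2 * Nr ^ 2 * (129600 + 1200 * (t * (1 + t))) + 96 * (t * (1 + t))) * u := by rw [hu]; ring
    rw [e]
    have h1 : 129600 + 1200 * (t * (1 + t)) ≤ 130800 * T := by linarith
    have h2 : 2 * Nr ^ 2 * (129600 + 1200 * (t * (1 + t))) ≤ K * (130800 * T) := mul_le_mul hN2 h1 (by positivity) (by positivity)
    have h3 : 96 * (t * (1 + t)) ≤ 96 * T := by linarith
    have h4 : (2 * Nr ^ 2 * (129600 + 1200 * (t * (1 + t))) + 96 * (t * (1 + t))) ≤ (130800 * K + 96) * T := by linarith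
    exact (mul_le_mul_of_nonneg_right h4 hu0).trans_eq (by ring)
  have hPot' : Pot ≤ 86 * Real.sqrt CK * (T * u) := by refine hPot.trans (le_of_eq ?_); rw [hu, hT]; ring
  -- sum
  have h2NCp : 0 ≤ 2 * Nr ^ 2 * Cp := by positivity
  have hstep : s * nv ≤ (2 * Nr ^ 2 * Cp * ((2 + 242 * Real.sqrt A₁) + (130800 * K + 96) + 1200) + 86 * Real.sqrt CK) * (T * u) := by
    have h := add_le_add (mul_le_mul_of_nonneg_left (add_le_add (add_le_add hF' hC') hJ1') h2NCp) hPot'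
    refine hmain.trans (h.trans (le_of_eq ?_)); ring
  have hK0 : 0 ≤ K := by linarith
  have hKsq1 : 1 ≤ K ^ 2 := by nlinarith
  have hcoef : 2 * Nr ^ 2 * Cp * ((2 + 242 * Real.sqrt A₁) + (130800 * K + 96) + 1200) + 86 * Real.sqrt CK
      ≤ (Cp * (132098 + 242 * Real.sqrt A₁) + 86 * Real.sqrt CK + 1) * K ^ 2 := by
    have hS0 : 0 ≤ (2 + 242 * Real.sqrt A₁) + (130800 * K + 96) + 1200 := by positivity
    have h1 : 2 * Nr ^ 2 * Cp * ((2 + 242 * Real.sqrt A₁) + (130800 * K + 96) + 1200) ≤ K * Cp * ((2 + 242 * Real.sqrt A₁) + (130800 * K + 96) + 1200) :=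
      mul_le_mul_of_nonneg_right (mul_le_mul_of_nonneg_right hN2 hCp.le) hS0
    have h2a : 242 * Real.sqrt A₁ * 1 ≤ 242 * Real.sqrt A₁ * K := mul_le_mul_of_nonneg_left hK1 (by positivity)
    have e0 : (132098 + 242 * Real.sqrt A₁) * K = 132098 * K + 242 * Real.sqrt A₁ * K := by ring
    have h2 : (2 + 242 * Real.sqrt A₁) + (130800 * K + 96) + 1200 ≤ (132098 + 242 * Real.sqrt A₁) * K := by rw [e0]; linarith
    have h3 : K * Cp * ((2 + 242 * Real.sqrt A₁) + (130800 * K + 96) + 1200) ≤ K * Cp * ((132098 + 242 * Real.sqrt A₁) * K) :=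
      mul_le_mul_of_nonneg_left h2 (mul_nonneg hK0 hCp.le)
    have h4 : 86 * Real.sqrt CK * 1 ≤ 86 * Real.sqrt CK * K ^ 2 := mul_le_mul_of_nonneg_left hKsq1 (by positivity)
    have e1 : K * Cp * ((132098 + 242 * Real.sqrt A₁) * K) = Cp * (132098 + 242 * Real.sqrt A₁) * K ^ 2 := by ring
    have e2 : (Cp * (132098 + 242 * Real.sqrt A₁) + 86 * Real.sqrt CK + 1) * K ^ 2
        = Cp * (132098 + 242 * Real.sqrt A₁) * K ^ 2 + 86 * Real.sqrt CK * K ^ 2 + K ^ 2 := by ring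
    rw [e2]
    linarith
  have e : (Cp * (132098 + 242 * Real.sqrt A₁) + 86 * Real.sqrt CK + 1) * K ^ 2 * T * Q / r
      = (Cp * (132098 + 242 * Real.sqrt A₁) + 86 * Real.sqrt CK + 1) * K ^ 2 * (T * u) := by rw [hu]; ring
  rw [e]
  exact hstep.trans (mul_le_mul_of_nonneg_right hcoef hTu)

end Summit.QuantumFields.YangMills.Theorems.Prop7CovWeightedRowScalings

end
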